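import Literature.NumberTheory.ModularForms.BinaryQuadGaussSumTwoPower
import Literature.NumberTheory.ModularForms.BinaryQuadGaussSumValues
import HarnessLib

/-!
# Gauss sums of binary quadratic forms, VII: the evaluation for EVERY modulus prime to `aD`
# — `∑_{x,y mod c} e(a f(x,y)/c) = χ₈(D)^k · (D/c) · c` (`c = 2^k·c'`, `D` odd) and its twisted form

Topic `NumberTheory/ModularForms` (namespace `Literature.NumberTheory.ModularForms`), assembling
files III (odd moduli: `(D/c)·c`), V (Chinese remainder theorem) and VI (`2^k`: `χ₈(D)^k·2^k`).
Everything here is PROVED (theorems only; no definition, no named fact). For a PRIMITIVE form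
`f = (A, B, C)` with ODD discriminant `D = B² − 4AC` (i.e. `B` odd — the case of the forms of
discriminant `−q`, `q ≡ 3 (mod 4)`, of an imaginary quadratic field with odd discriminant):

* `binQuadGaussSum_zero_zero_eq_all_moduli` — for `c = 2^k·c'` (`c'` odd) prime to `aD`:
  **`G(a, c; f, 0) = χ₈(D)^k · (D/c) · c`** (Jacobi symbol; Mathlib's `jacobiSym D c` has the
  factor `(D/2)^k = 1` for odd `D`, so the Kronecker symbol at `2` is the explicit `χ₈(D)^k`);
  in particular **`|G(a, c; f, 0)| = c`** (`norm_binQuadGaussSum_zero_zero_eq_all_moduli`).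
* `binQuadGaussSum_eq_all_moduli` — with a twist, **`G(a, c; f, w) = e(āD̄f̃(w)/c)·χ₈(D)^k·(D/c)·c`**,
  `f̃ = (C, −B, A)` (completing the square, file II, valid for every `c` prime to `aD`).

This is the evaluation of the Gauss sums of the binary theta series `θ_f(z) = ∑ e(z f(m,n))` at
ALL cusps `a/c` with `(c, D) = 1`, i.e. the arithmetic input of its transformation law there
(Andrianov–Zhuravlev Ch. 1 Proposition 4.9 / Theorem 4.10: `χ_Q(p) = ((−1)^k det Q / p)` and
(4.34) for `p = 2`); the cusps with `(c, D) = s > 1` are governed by files III/IV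
(`…_eq_jacobiSym_mul_binQuadGaussSum_one`: the character `(a/s)`; `norm_binQuadGaussSum_eq`:
modulus `c√s` and the congruence thinning the dual lattice).

## References

* A. N. Andrianov, V. G. Zhuravlev, *Modular Forms and Hecke Operators*, Transl. Math. Monogr.
  145, AMS (1995/2015), Ch. 1 §4.4 Proposition 4.9, Theorem 4.10 (4.31)–(4.34); §4.5 Lemma 4.13
  (4.49) [AndrianovZhuravlev2015].
* B. Conrey, H. Iwaniec, Acta Arith. 103 (2002) 259–312, §3 (3.14)–(3.21) [ConreyIwaniec2002].
-/

noncomputable section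

open Complex Finset

namespace Literature.NumberTheory.ModularForms

open Literature.NumberTheory.EllipticCurves.ModularForms
open Literature.NumberTheory.QuadraticFields.Quadratic (BinQF)
open Literature.NumberTheory.LFunctions (norm_stdAddChar)

open scoped NumberTheorySymbols

/-- `(D/2^k) = 1` for odd `D` (Mathlib's `jacobiSym` at the prime `2` is the Legendre symbol of
`ℤ/2`, trivial on odd residues) (plumbing). [folklore] -/
private theorem jacobiSym_two_pow_of_odd {D : ℤ} (hD : Odd D) (k : ℕ) : J(D | 2 ^ k) = 1 := by
  rw [jacobiSym.pow_right, jacobiSym.mod_left D 2]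
  simp only [Nat.cast_ofNat]
  rw [Int.odd_iff.mp hD, jacobiSym.one_left, one_pow]

/-- An integer prime to `c` is a unit mod `c` (plumbing). [folklore] -/
private theorem isUnit_intCast_of_gcd_eq_one'' {c : ℕ} {a : ℤ} (h : a.gcd c = 1) :
    IsUnit (a : ZMod c) := by
  obtain ⟨u, v, huv⟩ := Int.isCoprime_iff_gcd_eq_one.mpr h
  refine IsUnit.of_mul_eq_one (u : ZMod c) ?_
  have := congrArg (fun x : ℤ ↦ (x : ZMod c)) huv
  simp only [Int.cast_add, Int.cast_mul, Int.cast_natCast, ZMod.natCast_self, mul_zero, add_zero,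
    Int.cast_one] at this
  rw [mul_comm]
  exact this

/-- **The untwisted binary Gauss sum for every modulus prime to `aD`.** Let `f` be primitive
with `B` odd (odd discriminant `D`), `c = 2^k·c'` with `c'` odd, and `(a, c) = (D, c) = 1`. Then
`∑_{x,y mod c} e(a f(x,y)/c) = χ₈(D)^k · (D/c) · c`: the Chinese remainder theorem
`G(a, c) = G(c'a, 2^k)·G(2^k a, c')` (file V), `G(·, 2^k) = χ₈(D)^k 2^k` (file VI, the numerator
`c'a` being odd when `k ≥ 1`) and `G(·, c') = (D/c')c'` (file III), with `(D/c) = (D/2^k)(D/c')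
= (D/c')` for odd `D`. [cite: AndrianovZhuravlev2015, Ch. 1 §4.4 Proposition 4.9 and Theorem 4.10 (4.31)–(4.34), with §4.5 (4.49)] -/
theorem binQuadGaussSum_zero_zero_eq_all_moduli {f : BinQF} (hf : f.IsPrimitive) (hb : Odd f.b)
    {k c' : ℕ} (hc' : Odd c') {c : ℕ} [NeZero c] (hc : c = 2 ^ k * c') {a : ℤ}
    (ha : a.gcd c = 1) (hD : f.disc.gcd c = 1) :
    binQuadGaussSum c f a 0 0 = ((ZMod.χ₈ f.disc : ℤ) : ℂ) ^ k * jacobiSym f.disc c * c := by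
  subst hc
  haveI : NeZero (2 ^ k) := ⟨pow_ne_zero k two_ne_zero⟩
  haveI : NeZero c' := ⟨by rintro rfl; exact (NeZero.ne (2 ^ k * 0)) (mul_zero _)⟩
  have hcop : Nat.Coprime (2 ^ k) c' := (Nat.coprime_two_left.mpr hc').pow_left k
  have cop := fun {x : ℤ} {n : ℕ} (h : x.gcd n = 1) ↦ Int.isCoprime_iff_gcd_eq_one.mpr h
  have hDodd : Odd f.disc := by
    rw [BinQF.disc, show f.b ^ 2 - 4 * f.a * f.c = f.b ^ 2 + 2 * (-(2 * f.a * f.c)) by ring]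
    exact (hb.pow).add_even (even_two_mul _)
  -- coprimality to the two factors
  have dvd₂ : ((c' : ℕ) : ℤ) ∣ ((2 ^ k * c' : ℕ) : ℤ) := ⟨2 ^ k, by push_cast; ring⟩
  have dvd₁ : ((2 ^ k : ℕ) : ℤ) ∣ ((2 ^ k * c' : ℕ) : ℤ) := ⟨c', by push_cast; ring⟩
  have h2c : IsCoprime ((2 ^ k : ℕ) : ℤ) (c' : ℤ) := Nat.isCoprime_iff_coprime.mpr hcop
  have ha' : (((2 ^ k : ℕ) : ℤ) * a).gcd c' = 1 :=
    Int.isCoprime_iff_gcd_eq_one.mp (h2c.mul_left ((cop ha).of_isCoprime_of_dvd_right dvd₂))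
  have hD' : f.disc.gcd c' = 1 :=
    Int.isCoprime_iff_gcd_eq_one.mp ((cop hD).of_isCoprime_of_dvd_right dvd₂)
  -- split by the Chinese remainder theorem
  rw [show (0 : ZMod (2 ^ k * c')) = ((0 : ℤ) : ZMod (2 ^ k * c')) from Int.cast_zero.symm,
    binQuadGaussSum_mul_of_coprime hcop f a 0 0]
  simp only [Int.cast_zero]
  rw [binQuadGaussSum_zero_zero_eq_jacobiSym_mul_of_isPrimitive hc' hf ha' hD',
    jacobiSym.mul_right' f.disc (NeZero.ne (2 ^ k)) (NeZero.ne c'),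
    jacobiSym_two_pow_of_odd hDodd k, one_mul]
  -- the `2`-part
  rcases Nat.eq_zero_or_pos k with rfl | hk
  · rw [binQuadGaussSum_eq_one_of_modulus_eq_one (pow_zero 2)]
    push_cast
    ring
  · have haodd : Odd ((c' : ℤ) * a) := by
      refine (Int.odd_coe_nat c' |>.mpr hc').mul ?_
      rw [← Int.not_even_iff_odd, even_iff_two_dvd]
      intro h2a
      have h2c : (2 : ℤ) ∣ ((2 ^ k * c' : ℕ) : ℤ) :=
        ⟨2 ^ (k - 1) * c', by
          rw [show k = (k - 1) + 1 from (Nat.sub_add_cancel hk).symm]; push_cast; ring⟩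
      have := Int.dvd_gcd h2a h2c
      rw [ha] at this
      norm_num at this
    rw [binQuadGaussSum_two_pow_eq f hb haodd k]
    push_cast
    ring

/-- **`|G(a, c; f, 0)| = c` for every modulus `c` prime to `aD`** (`f` primitive, `D` odd).
[cite: AndrianovZhuravlev2015, Ch. 1 §4.4 Proposition 4.9 and Theorem 4.10] -/
theorem norm_binQuadGaussSum_zero_zero_eq_all_moduli {f : BinQF} (hf : f.IsPrimitive)
    (hb : Odd f.b) {k c' : ℕ} (hc' : Odd c') {c : ℕ} [NeZero c] (hc : c = 2 ^ k * c') {a : ℤ}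
    (ha : a.gcd c = 1) (hD : f.disc.gcd c = 1) :
    ‖binQuadGaussSum c f a 0 0‖ = c := by
  have hDodd : Odd f.disc := by
    rw [BinQF.disc, show f.b ^ 2 - 4 * f.a * f.c = f.b ^ 2 + 2 * (-(2 * f.a * f.c)) by ring]
    exact (hb.pow).add_even (even_two_mul _)
  have hχ : ‖((ZMod.χ₈ f.disc : ℤ) : ℂ)‖ = 1 := by
    rw [ZMod.χ₈_int_eq_if_mod_eight]
    have : f.disc % 2 = 1 := Int.odd_iff.mp hDodd
    rw [if_neg (by omega)]
    split_ifs <;> norm_num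
  have hJ : ‖((jacobiSym f.disc c : ℤ) : ℂ)‖ = 1 := by
    rcases jacobiSym.eq_one_or_neg_one hD with h | h <;> rw [h] <;> simp
  rw [binQuadGaussSum_zero_zero_eq_all_moduli hf hb hc' hc ha hD, norm_mul, norm_mul, norm_pow,
    hχ, hJ, one_pow, one_mul, one_mul, Complex.norm_natCast]

/-- **The twisted binary Gauss sum for every modulus prime to `aD`**: for `f` primitive with
odd `D`, `c = 2^k·c'` (`c'` odd), `(a, c) = (D, c) = 1` and any twist `w`,
`G(a, c; f, w) = e(ā·D̄·(Cw₁² − Bw₁w₂ + Aw₂²)/c) · χ₈(D)^k · (D/c) · c`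
(completing the square — no parity hypothesis — and the untwisted value).
[cite: AndrianovZhuravlev2015, Ch. 1 §4.3–4.4, (4.13)–(4.14), Proposition 4.9 and Theorem 4.10] -/
theorem binQuadGaussSum_eq_all_moduli {f : BinQF} (hf : f.IsPrimitive) (hb : Odd f.b)
    {k c' : ℕ} (hc' : Odd c') {c : ℕ} [NeZero c] (hc : c = 2 ^ k * c') {a : ℤ}
    (ha : a.gcd c = 1) (hD : f.disc.gcd c = 1) (w₁ w₂ : ZMod c) :
    binQuadGaussSum c f a w₁ w₂ =
      (ZMod.stdAddChar ((a : ZMod c)⁻¹ * ((f.disc : ℤ) : ZMod c)⁻¹ *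
          ((f.c : ZMod c) * w₁ ^ 2 - (f.b : ZMod c) * w₁ * w₂ + (f.a : ZMod c) * w₂ ^ 2)) : ℂ) *
        (((ZMod.χ₈ f.disc : ℤ) : ℂ) ^ k * jacobiSym f.disc c * c) := by
  rw [binQuadGaussSum_eq_stdAddChar_mul f (isUnit_intCast_of_gcd_eq_one'' ha)
      (isUnit_intCast_of_gcd_eq_one'' hD) w₁ w₂,
    binQuadGaussSum_zero_zero_eq_all_moduli hf hb hc' hc ha hD]

/-- **`|G(a, c; f, w)| = c` for every modulus `c` prime to `aD` and every twist** (`f` primitive,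
`D` odd). [cite: AndrianovZhuravlev2015, Ch. 1 §4.4 Proposition 4.9 and Theorem 4.10] -/
theorem norm_binQuadGaussSum_eq_all_moduli {f : BinQF} (hf : f.IsPrimitive) (hb : Odd f.b)
    {k c' : ℕ} (hc' : Odd c') {c : ℕ} [NeZero c] (hc : c = 2 ^ k * c') {a : ℤ}
    (ha : a.gcd c = 1) (hD : f.disc.gcd c = 1) (w₁ w₂ : ZMod c) :
    ‖binQuadGaussSum c f a w₁ w₂‖ = c := by
  rw [binQuadGaussSum_eq_stdAddChar_mul f (isUnit_intCast_of_gcd_eq_one'' ha)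
      (isUnit_intCast_of_gcd_eq_one'' hD) w₁ w₂, norm_mul, norm_stdAddChar, one_mul,
    norm_binQuadGaussSum_zero_zero_eq_all_moduli hf hb hc' hc ha hD]

end Literature.NumberTheory.ModularForms

end
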